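import Literature.Probability.LatticeModels.WeaklyCoupledChainCondExp
import HarnessLib

/-!
# Weakly coupled chains: the martingale-increment recursion (one-step variance bound)

`Literature/Probability/LatticeModels/` — third file of the `WeaklyCoupledChain*` series. For a
nearest-neighbour chain on `[0, L]^N` with step factors pinched in `[φ₋, φ₊]` (`ρ₀ = φ₊/φ₋`) and
an observable `f` with a continuous partial derivative `∂_k f` along the coordinate `k < N`, the
conditional variance of `E_{k+1} f` given the first `k` coordinates obeys

  `E_k[(E_{k+1}f - E_k f)²] ≤ 2ρ₀⁶L² · E_k[(∂_k f)²] + 2ρ₀⁴(ρ₀-1)² · E_k[(E_{k+2}f - E_{k+1}f)²]`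

(`condExp_sq_increment_le`). The first term comes from the Poincaré inequality on `[0, L]`
(fundamental theorem of calculus + Cauchy–Schwarz along the coordinate `k`,
`sq_condExp_section_sub_le`), the second from the weak dependence of the conditional law of
the tail on `q_k` through the single factor `φ_{k+1}`: a covariance with a function of `q_{k+1}`
bounded by `ρ₀ - 1`, which only sees the NEXT increment (`abs_condExp_update_sub_le`). At weak
coupling `ρ₀ → 1` the second coefficient is a contraction; iterating gives the uniform Poincaré
inequality and the exponential decay of correlations (next file). All [folklore] (the
transfer-operator / martingale method for one-dimensional Gibbs measures). No definitions.
-/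

noncomputable section

open MeasureTheory Function Set Filter
open scoped ENNReal Topology

namespace Literature.Probability.LatticeModels

namespace BoxChain

variable {N : ℕ}

namespace Spec

variable (S : Spec N)

/-! ### The one-step variance bound (the engine of the recursion) -/

section Step

/-- **First term**: the conditional expectation of an increment along the coordinate `k` is
controlled by the Dirichlet energy in that coordinate:
`(E_{k+1}[f(·[k↦t]) - f(·[k↦s])](q[k↦t]))² ≤ ρ₀⁶ L² E_k[(∂_k f)²](q)`. [folklore] -/
theorem sq_condExp_section_sub_le {k : ℕ} (hk : k < N) {f f' : (Fin N → ℝ) → ℝ}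
    (hf : Continuous f) (hf' : Continuous f')
    (hd : ∀ (p : Fin N → ℝ) (r : ℝ), HasDerivAt (fun r => f (update p ⟨k, hk⟩ r)) (f' (update p ⟨k, hk⟩ r)) r)
    (q : Fin N → ℝ) {t s : ℝ} (ht : t ∈ Icc 0 S.L) (hs : s ∈ Icc 0 S.L) :
    (S.condExp (k + 1) (fun p => f (update p ⟨k, hk⟩ t) - f (update p ⟨k, hk⟩ s)) (update q ⟨k, hk⟩ t)) ^ 2 ≤
      S.ratio ^ 6 * S.L ^ 2 * S.condExp k (fun p => f' p ^ 2) q := by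
  -- the increment and the single-coordinate energy
  have hF : Continuous fun p => f (update p ⟨k, hk⟩ t) - f (update p ⟨k, hk⟩ s) :=
    (hf.comp (continuous_id.update _ continuous_const)).sub (hf.comp (continuous_id.update _ continuous_const))
  have hF2 : Continuous fun p => (f (update p ⟨k, hk⟩ t) - f (update p ⟨k, hk⟩ s)) ^ 2 := hF.pow 2
  have hf'2 : Continuous fun p => f' p ^ 2 := hf'.pow 2
  have hM : Continuous (marginal S.L {(⟨k, hk⟩ : Fin N)} fun p => f' p ^ 2) := continuous_marginal hf'2
  have hLM : Continuous fun p => S.L * marginal S.L {(⟨k, hk⟩ : Fin N)} (fun p => f' p ^ 2) p :=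
    continuous_const.mul hM
  have hM0 : ∀ p, 0 ≤ marginal S.L {(⟨k, hk⟩ : Fin N)} (fun p => f' p ^ 2) p :=
    fun p => marginal_nonneg (fun _ => sq_nonneg _) p
  have hMdep : DependsOn (marginal S.L {(⟨k, hk⟩ : Fin N)} fun p => f' p ^ 2) {j : Fin N | j ≠ ⟨k, hk⟩} :=
    (dependsOn_marginal S.L {(⟨k, hk⟩ : Fin N)} _).mono fun j hj => by simpa using hj
  -- step 1: Jensen
  have h1 := S.sq_condExp_le (k + 1) hF (update q ⟨k, hk⟩ t)
  -- step 2: pointwise FTC bound and monotonicity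
  have h2 : S.condExp (k + 1) (fun p => (f (update p ⟨k, hk⟩ t) - f (update p ⟨k, hk⟩ s)) ^ 2) (update q ⟨k, hk⟩ t) ≤
      S.L * S.condExp (k + 1) (marginal S.L {(⟨k, hk⟩ : Fin N)} fun p => f' p ^ 2) (update q ⟨k, hk⟩ t) := by
    have hmono := S.condExp_mono (k + 1)
      (h := fun p => (f (update p ⟨k, hk⟩ t) - f (update p ⟨k, hk⟩ s)) ^ 2)
      (h' := fun p => S.L * marginal S.L {(⟨k, hk⟩ : Fin N)} (fun p => f' p ^ 2) p) hF2 hLM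
      (fun p => sq_sub_le_mul_marginal_sq (L := S.L) hf' hd ht hs p) (update q ⟨k, hk⟩ t)
    have e := S.condExp_mul_left (k + 1) (g := fun _ => S.L) (fun _ _ _ => rfl)
      (marginal S.L {(⟨k, hk⟩ : Fin N)} fun p => f' p ^ 2)
    rw [e] at hmono
    exact hmono
  -- step 3: ratio bound + lower averaging
  have h3 : S.condExp (k + 1) (marginal S.L {(⟨k, hk⟩ : Fin N)} fun p => f' p ^ 2) (update q ⟨k, hk⟩ t) ≤
      S.ratio ^ 4 * S.condExp k (marginal S.L {(⟨k, hk⟩ : Fin N)} fun p => f' p ^ 2) q := by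
    have hρ4 : 0 < S.ratio ^ 4 := pow_pos (lt_of_lt_of_le one_pos (S.one_le_ratio (Fin.pos ⟨k, hk⟩))) 4
    have hlow := S.le_condExp_of_forall_le hk hM q
      (B := S.condExp (k + 1) (marginal S.L {(⟨k, hk⟩ : Fin N)} fun p => f' p ^ 2) (update q ⟨k, hk⟩ t) / S.ratio ^ 4)
      fun t' _ => by
        rw [div_le_iff₀ hρ4, mul_comm]
        exact S.condExp_update_le_ratio_pow_mul hk hM hM0 hMdep q t t'
    rwa [div_le_iff₀ hρ4, mul_comm] at hlow
  -- step 4: remove the single-coordinate average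
  have h4 := S.condExp_marginal_singleton_le hk hf'2 (fun _ => sq_nonneg _) q
  have hρ0 : 0 ≤ S.ratio := le_trans zero_le_one (S.one_le_ratio (Fin.pos ⟨k, hk⟩))
  calc (S.condExp (k + 1) (fun p => f (update p ⟨k, hk⟩ t) - f (update p ⟨k, hk⟩ s)) (update q ⟨k, hk⟩ t)) ^ 2
      ≤ S.condExp (k + 1) (fun p => (f (update p ⟨k, hk⟩ t) - f (update p ⟨k, hk⟩ s)) ^ 2) (update q ⟨k, hk⟩ t) := h1
    _ ≤ S.L * S.condExp (k + 1) (marginal S.L {(⟨k, hk⟩ : Fin N)} fun p => f' p ^ 2) (update q ⟨k, hk⟩ t) := h2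
    _ ≤ S.L * (S.ratio ^ 4 * S.condExp k (marginal S.L {(⟨k, hk⟩ : Fin N)} fun p => f' p ^ 2) q) :=
        mul_le_mul_of_nonneg_left h3 S.L_pos.le
    _ ≤ S.L * (S.ratio ^ 4 * (S.ratio ^ 2 * S.L * S.condExp k (fun p => f' p ^ 2) q)) :=
        mul_le_mul_of_nonneg_left (mul_le_mul_of_nonneg_left h4 (pow_nonneg hρ0 4)) S.L_pos.le
    _ = S.ratio ^ 6 * S.L ^ 2 * S.condExp k (fun p => f' p ^ 2) q := by ring

/-- **Second term**: for `g` not depending on the coordinate `k`, the dependence of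
`E_{k+1} g (q[k ↦ t])` on `t` is a covariance with a bounded function of `q_{k+1}`:
`|E_{k+1} g (q[k↦t]) - E_{k+1} g (q[k↦s])| ≤ ρ₀²(ρ₀ - 1) E_{k+1}[|E_{k+2} g - E_{k+1} g|](q[k↦s])`. [folklore] -/
theorem abs_condExp_update_sub_le {k : ℕ} (hk : k < N) {g : (Fin N → ℝ) → ℝ} (hg : Continuous g)
    (hgk : DependsOn g {j : Fin N | j ≠ ⟨k, hk⟩}) (q : Fin N → ℝ) (t s : ℝ) :
    |S.condExp (k + 1) g (update q ⟨k, hk⟩ t) - S.condExp (k + 1) g (update q ⟨k, hk⟩ s)| ≤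
      S.ratio ^ 2 * (S.ratio - 1) *
        S.condExp (k + 1) (fun p => |S.condExp (k + 2) g p - S.condExp (k + 1) g p|) (update q ⟨k, hk⟩ s) := by
  have hN : 0 < N := lt_of_le_of_lt (Nat.zero_le k) hk
  have hρ : 1 ≤ S.ratio := S.one_le_ratio hN
  have hρ0 : 0 < S.ratio := lt_of_lt_of_le one_pos hρ
  by_cases hk1 : k + 1 < N
  swap
  · -- nothing is integrated at the levels `k+1, k+2`
    have hle : N ≤ k + 1 := not_lt.mp hk1
    rw [S.condExp_of_le hle, S.condExp_of_le (k := k + 2) (by omega)]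
    have h0 : g (update q ⟨k, hk⟩ t) = g (update q ⟨k, hk⟩ s) :=
      hgk fun j hj => by rw [update_of_ne hj, update_of_ne hj]
    rw [h0, sub_self, abs_zero]
    simp [S.condExp_const]
  -- the multiplier `m = φ_{k+1}(·[k↦t]) / φ_{k+1}(·[k↦s]) - 1`, a function of `q_{k+1}` alone
  have hφpos : ∀ p, 0 < S.φ ⟨k + 1, hk1⟩ p := fun p => S.φlo_pos.trans_le (S.φlo_le _ _)
  obtain ⟨m, hm⟩ : ∃ m : (Fin N → ℝ) → ℝ, ∀ p,
      m p = S.φ ⟨k + 1, hk1⟩ (update p ⟨k, hk⟩ t) / S.φ ⟨k + 1, hk1⟩ (update p ⟨k, hk⟩ s) - 1 :=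
    ⟨_, fun p => rfl⟩
  have hm_cont : Continuous m := by
    have e : m = fun p => S.φ ⟨k + 1, hk1⟩ (update p ⟨k, hk⟩ t) / S.φ ⟨k + 1, hk1⟩ (update p ⟨k, hk⟩ s) - 1 :=
      funext hm
    rw [e]
    exact (((S.continuous_φ _).comp (continuous_id.update _ continuous_const)).div
      ((S.continuous_φ _).comp (continuous_id.update _ continuous_const)) fun p => (hφpos _).ne').sub
      continuous_const
  have hm_dep : DependsOn m {j : Fin N | j.val < k + 2} := by
    intro p p' hpp'
    have key : ∀ r : ℝ, S.φ ⟨k + 1, hk1⟩ (update p ⟨k, hk⟩ r) = S.φ ⟨k + 1, hk1⟩ (update p' ⟨k, hk⟩ r) := by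
      intro r
      refine S.dependsOn_φ ⟨k + 1, hk1⟩ fun j hj => ?_
      by_cases hji : j = ⟨k, hk⟩
      · subst hji; simp
      · rw [update_of_ne hji, update_of_ne hji]
        refine hpp' j ?_
        simp only [Set.mem_setOf_eq] at hj ⊢
        rcases hj with hj | hj
        · have : j.val + 1 = k + 1 := hj
          omega
        · rw [hj]; show k + 1 < k + 2; omega
    rw [hm, hm, key t, key s]
  have hm_abs : ∀ p, |m p| ≤ S.ratio - 1 := by
    intro p
    have hup : S.φ ⟨k + 1, hk1⟩ (update p ⟨k, hk⟩ t) ≤ S.ratio * S.φ ⟨k + 1, hk1⟩ (update p ⟨k, hk⟩ s) :=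
      S.φ_le_ratio_mul _ _ _
    have hlo : S.φ ⟨k + 1, hk1⟩ (update p ⟨k, hk⟩ s) ≤ S.ratio * S.φ ⟨k + 1, hk1⟩ (update p ⟨k, hk⟩ t) :=
      S.φ_le_ratio_mul _ _ _
    have ha := hφpos (update p ⟨k, hk⟩ t)
    have hb := hφpos (update p ⟨k, hk⟩ s)
    rw [hm, abs_le]
    constructor
    · rw [le_sub_iff_add_le, le_div_iff₀ hb]
      -- `(2 - ρ) φ_s ≤ φ_t` from `φ_s ≤ ρ φ_t` and `(2 - ρ) ρ ≤ 1`
      nlinarith [mul_nonneg hb.le (sq_nonneg (S.ratio - 1)), mul_nonneg ha.le (sq_nonneg (S.ratio - 1)),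
        hlo, hup, ha, hb, hρ]
    · rw [sub_le_sub_iff_right, div_le_iff₀ hb]
      exact hup
  -- the fibre identities
  have hfib : ∀ (y : ↥(tail (N := N) (k + 1)) → ℝ) (h : (Fin N → ℝ) → ℝ),
      DependsOn h {j : Fin N | j ≠ ⟨k, hk⟩} →
      h (updateFinset (update q ⟨k, hk⟩ t) (tail (k + 1)) y) *
          S.weight (k + 1) (updateFinset (update q ⟨k, hk⟩ t) (tail (k + 1)) y) =
        (m (updateFinset (update q ⟨k, hk⟩ s) (tail (k + 1)) y) + 1) *
          (h (updateFinset (update q ⟨k, hk⟩ s) (tail (k + 1)) y) *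
            S.weight (k + 1) (updateFinset (update q ⟨k, hk⟩ s) (tail (k + 1)) y)) := by
    intro y h hh
    rw [updateFinset_update_tail hk, updateFinset_update_tail hk]
    have hg' : h (update (updateFinset q (tail (k + 1)) y) ⟨k, hk⟩ t) =
        h (update (updateFinset q (tail (k + 1)) y) ⟨k, hk⟩ s) :=
      hh fun j hj => by rw [update_of_ne hj, update_of_ne hj]
    have hW2 : S.weight (k + 2) (update (updateFinset q (tail (k + 1)) y) ⟨k, hk⟩ t) =
        S.weight (k + 2) (update (updateFinset q (tail (k + 1)) y) ⟨k, hk⟩ s) :=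
      S.dependsOn_weight (k + 2) fun j hj => by
        have hji : j ≠ ⟨k, hk⟩ := by
          rintro rfl
          simp only [Set.mem_setOf_eq] at hj
          omega
        rw [update_of_ne hji, update_of_ne hji]
    have hm1 : m (update (updateFinset q (tail (k + 1)) y) ⟨k, hk⟩ s) + 1 =
        S.φ ⟨k + 1, hk1⟩ (update (updateFinset q (tail (k + 1)) y) ⟨k, hk⟩ t) /
          S.φ ⟨k + 1, hk1⟩ (update (updateFinset q (tail (k + 1)) y) ⟨k, hk⟩ s) := by
      rw [hm, update_idem, update_idem]; ring
    have hws : ∀ r, S.weight (k + 1) (update (updateFinset q (tail (k + 1)) y) ⟨k, hk⟩ r) =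
        S.φ ⟨k + 1, hk1⟩ (update (updateFinset q (tail (k + 1)) y) ⟨k, hk⟩ r) *
          S.weight (k + 2) (update (updateFinset q (tail (k + 1)) y) ⟨k, hk⟩ r) :=
      fun r => S.weight_succ hk1 _
    rw [hws t, hws s, hg', hW2, hm1]
    have hb := hφpos (update (updateFinset q (tail (k + 1)) y) ⟨k, hk⟩ s)
    field_simp
  -- numerators and denominators
  have hgW : Continuous fun p => g p * S.weight (k + 1) p := hg.mul (S.continuous_weight _)
  have hmgW : Continuous fun p => m p * (g p * S.weight (k + 1) p) := hm_cont.mul hgW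
  have hmW : Continuous fun p => m p * S.weight (k + 1) p := hm_cont.mul (S.continuous_weight _)
  set Ns := marginal S.L (tail (k + 1)) (fun p => g p * S.weight (k + 1) p) (update q ⟨k, hk⟩ s) with hNs
  set Nt := marginal S.L (tail (k + 1)) (fun p => g p * S.weight (k + 1) p) (update q ⟨k, hk⟩ t) with hNt
  set Ds := S.msg (k + 1) (update q ⟨k, hk⟩ s) with hDs
  set Dt := S.msg (k + 1) (update q ⟨k, hk⟩ t) with hDt
  set A := marginal S.L (tail (k + 1)) (fun p => m p * (g p * S.weight (k + 1) p)) (update q ⟨k, hk⟩ s) with hA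
  set B := marginal S.L (tail (k + 1)) (fun p => m p * S.weight (k + 1) p) (update q ⟨k, hk⟩ s) with hB
  have hNum : Nt = A + Ns := by
    have e : Nt = marginal S.L (tail (k + 1))
        ((fun p => m p * (g p * S.weight (k + 1) p)) + fun p => g p * S.weight (k + 1) p) (update q ⟨k, hk⟩ s) := by
      refine marginal_congr_fibre' _ _ _ _ fun y => ?_
      rw [hfib y g hgk, Pi.add_apply]; ring
    rw [e, marginal_add (f := fun p => m p * (g p * S.weight (k + 1) p))
      (g := fun p => g p * S.weight (k + 1) p) hmgW hgW]
    rfl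
  have hDen : Dt = B + Ds := by
    have e : Dt = marginal S.L (tail (k + 1))
        ((fun p => m p * S.weight (k + 1) p) + S.weight (k + 1)) (update q ⟨k, hk⟩ s) := by
      rw [hDt, msg]
      refine marginal_congr_fibre' _ _ _ _ fun y => ?_
      have h1 := hfib y (fun _ => 1) (fun _ _ _ => rfl)
      simp only [one_mul] at h1
      rw [h1, Pi.add_apply]; ring
    rw [e, marginal_add (f := fun p => m p * S.weight (k + 1) p) (g := S.weight (k + 1)) hmW
      (S.continuous_weight _)]
    rfl
  have hDs_pos : 0 < Ds := S.msg_pos _ _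
  have hDt_pos : 0 < Dt := S.msg_pos _ _
  -- the covariance identity, with `c = E_{k+1} g (q[k↦s])`
  set c := S.condExp (k + 1) g (update q ⟨k, hk⟩ s) with hc
  have hc_eq : c = Ns / Ds := rfl
  have hcov : S.condExp (k + 1) g (update q ⟨k, hk⟩ t) - c =
      Ds / Dt * S.condExp (k + 1) (fun p => m p * (g p - c)) (update q ⟨k, hk⟩ s) := by
    have e1 : S.condExp (k + 1) g (update q ⟨k, hk⟩ t) = Nt / Dt := rfl
    have e2 : S.condExp (k + 1) (fun p => m p * (g p - c)) (update q ⟨k, hk⟩ s) =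
        marginal S.L (tail (k + 1)) (fun p => m p * (g p - c) * S.weight (k + 1) p) (update q ⟨k, hk⟩ s) / Ds := rfl
    have e3 : marginal S.L (tail (k + 1)) (fun p => m p * (g p - c) * S.weight (k + 1) p) (update q ⟨k, hk⟩ s) =
        A - c * B := by
      have e : (fun p => m p * (g p - c) * S.weight (k + 1) p) =
          (fun p => m p * (g p * S.weight (k + 1) p)) - fun p => c * (m p * S.weight (k + 1) p) := by
        funext p; simp only [Pi.sub_apply]; ring
      rw [e, marginal_sub (f := fun p => m p * (g p * S.weight (k + 1) p))
        (g := fun p => c * (m p * S.weight (k + 1) p)) hmgW (continuous_const.mul hmW),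
        marginal_const_mul]
      rfl
    have hBD : B + Ds ≠ 0 := fun h0 => by rw [← hDen] at h0; exact hDt_pos.ne' h0
    have hDs0 : Ds ≠ 0 := hDs_pos.ne'
    rw [e1, e2, e3, hNum, hDen, hc_eq]
    field_simp
    ring
  -- pass to `E_{k+2}` inside
  have hgc : Continuous fun p => g p - c := hg.sub continuous_const
  have hinner : S.condExp (k + 1) (fun p => m p * (g p - c)) (update q ⟨k, hk⟩ s) =
      S.condExp (k + 1) (fun p => m p * (S.condExp (k + 2) g p - c)) (update q ⟨k, hk⟩ s) := by
    have htower := S.condExp_condExp_succ (k + 1) (h := fun p => m p * (g p - c)) (hm_cont.mul hgc)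
    rw [show k + 1 + 1 = k + 2 from rfl] at htower
    rw [← htower]
    congr 1
    rw [S.condExp_mul_left (k + 2) hm_dep]
    funext p
    congr 1
    have hsub := S.condExp_sub (k + 2) (f := g) (g := fun _ => c) hg continuous_const
    rw [S.condExp_const] at hsub
    exact congrFun hsub p
  -- bound
  have hratio : Ds / Dt ≤ S.ratio ^ 2 := by
    rw [div_le_iff₀ hDt_pos]
    exact S.msg_succ_update_le hk q s t
  have hX : Continuous fun p => S.condExp (k + 2) g p - c := (S.continuous_condExp _ hg).sub continuous_const
  have habs : |S.condExp (k + 1) (fun p => m p * (S.condExp (k + 2) g p - c)) (update q ⟨k, hk⟩ s)| ≤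
      (S.ratio - 1) * S.condExp (k + 1) (fun p => |S.condExp (k + 2) g p - c|) (update q ⟨k, hk⟩ s) := by
    refine (S.abs_condExp_le (k + 1) _ _).trans ?_
    have hmono := S.condExp_mono (k + 1)
      (h := fun p => |m p * (S.condExp (k + 2) g p - c)|)
      (h' := fun p => (S.ratio - 1) * |S.condExp (k + 2) g p - c|)
      ((hm_cont.mul hX).abs) (continuous_const.mul hX.abs)
      (fun p => by
        show |m p * (S.condExp (k + 2) g p - c)| ≤ (S.ratio - 1) * |S.condExp (k + 2) g p - c|
        rw [abs_mul]; exact mul_le_mul_of_nonneg_right (hm_abs p) (abs_nonneg _)) (update q ⟨k, hk⟩ s)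
    have e := S.condExp_mul_left (k + 1) (g := fun _ => S.ratio - 1) (fun _ _ _ => rfl)
      (fun p => |S.condExp (k + 2) g p - c|)
    rw [e] at hmono
    exact hmono
  -- identify `c` with the function `E_{k+1} g` on the fibre
  have hfun : S.condExp (k + 1) (fun p => |S.condExp (k + 2) g p - c|) (update q ⟨k, hk⟩ s) =
      S.condExp (k + 1) (fun p => |S.condExp (k + 2) g p - S.condExp (k + 1) g p|) (update q ⟨k, hk⟩ s) := by
    refine S.condExp_congr_fibre (k + 1) _ _ _ fun y => ?_
    have hcy : S.condExp (k + 1) g (updateFinset (update q ⟨k, hk⟩ s) (tail (k + 1)) y) = c :=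
      S.dependsOn_condExp (k + 1) g fun j hj => by
        have hjt : j ∉ tail (N := N) (k + 1) := by simpa using hj
        simp [updateFinset, hjt]
    rw [hcy]
  rw [← hfun, hcov, hinner, abs_mul, abs_of_pos (div_pos hDs_pos hDt_pos)]
  calc Ds / Dt * |S.condExp (k + 1) (fun p => m p * (S.condExp (k + 2) g p - c)) (update q ⟨k, hk⟩ s)|
      ≤ S.ratio ^ 2 * ((S.ratio - 1) *
          S.condExp (k + 1) (fun p => |S.condExp (k + 2) g p - c|) (update q ⟨k, hk⟩ s)) :=
        mul_le_mul hratio habs (abs_nonneg _) (by positivity)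
    _ = _ := by ring

end Step

section StepMain

/-- **The one-step variance bound.** For `f` with a continuous partial derivative `f'` along the
coordinate `k < N`, the conditional variance of `E_{k+1} f` given the first `k` coordinates is
controlled by the energy in the coordinate `k` and by the NEXT increment:
`E_k[(E_{k+1}f - E_k f)²] ≤ A · E_k[(∂_k f)²] + θ · E_k[(E_{k+2}f - E_{k+1}f)²]`
(`A = 2ρ₀⁶L²`, `θ = 2ρ₀⁴(ρ₀-1)²`). This is the martingale-increment recursion behind the uniform
Poincaré inequality and the decay of correlations of weakly coupled chains. [folklore] -/
theorem condExp_sq_increment_le {k : ℕ} (hk : k < N) {f f' : (Fin N → ℝ) → ℝ}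
    (hf : Continuous f) (hf' : Continuous f')
    (hd : ∀ (p : Fin N → ℝ) (r : ℝ), HasDerivAt (fun r => f (update p ⟨k, hk⟩ r)) (f' (update p ⟨k, hk⟩ r)) r)
    (q : Fin N → ℝ) :
    S.condExp k (fun p => (S.condExp (k + 1) f p - S.condExp k f p) ^ 2) q ≤
      (2 * S.ratio ^ 6 * S.L ^ 2) * S.condExp k (fun p => f' p ^ 2) q +
        (2 * (S.ratio ^ 2 * (S.ratio - 1)) ^ 2) *
          S.condExp k (fun p => (S.condExp (k + 2) f p - S.condExp (k + 1) f p) ^ 2) q := by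
  -- notation: `u = E_{k+1} f`, `ū = E_k f (q)`, `d₂ = E_{k+2} f - E_{k+1} f`
  have hu : Continuous (S.condExp (k + 1) f) := S.continuous_condExp _ hf
  have hEk : Continuous (S.condExp k f) := S.continuous_condExp _ hf
  have hd2 : Continuous fun p => (S.condExp (k + 2) f p - S.condExp (k + 1) f p) ^ 2 :=
    ((S.continuous_condExp _ hf).sub hu).pow 2
  set α : ℝ := S.ratio ^ 6 * S.L ^ 2 * S.condExp k (fun p => f' p ^ 2) q with hα
  set δ : ℝ := S.ratio ^ 2 * (S.ratio - 1) with hδ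
  set ū : ℝ := S.condExp k f q with hū
  -- the comparison function `H' = 2α + 2δ² d₂²`
  have hH' : Continuous fun p => 2 * α + 2 * δ ^ 2 * (S.condExp (k + 2) f p - S.condExp (k + 1) f p) ^ 2 :=
    continuous_const.add (continuous_const.mul hd2)
  -- `E_k f` is constant `= ū` on the fibre of `q` and on the points `q[k ↦ t]`
  have hūt : ∀ t, S.condExp k f (update q ⟨k, hk⟩ t) = ū := fun t =>
    S.dependsOn_condExp k f fun j hj => by
      have hjk : j ≠ ⟨k, hk⟩ := by rintro rfl; simp at hj
      rw [update_of_ne hjk]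
  -- (i) for every `t`: `E_{k+1}[(u - E_k f)²](q[k↦t]) = (u(q[k↦t]) - ū)²`
  have hi : ∀ t, S.condExp (k + 1) (fun p => (S.condExp (k + 1) f p - S.condExp k f p) ^ 2) (update q ⟨k, hk⟩ t) =
      (S.condExp (k + 1) f (update q ⟨k, hk⟩ t) - ū) ^ 2 := by
    intro t
    have hdep : DependsOn (fun p => (S.condExp (k + 1) f p - S.condExp k f p) ^ 2) {i : Fin N | i.val < k + 1} := by
      intro p p' hpp'
      have h1 := S.dependsOn_condExp (k + 1) f hpp'
      have h2 := S.dependsOn_condExp k f fun i hi => hpp' i (by simp only [Set.mem_setOf_eq] at hi ⊢; omega)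
      simp only [h1, h2]
    rw [S.condExp_of_dependsOn (k + 1) hdep]
    beta_reduce
    rw [hūt t]
  -- (ii) for every `t, s ∈ [0,L]`: `(u(q_t) - u(q_s))² ≤ 2α + 2δ² E_{k+1}[d₂²](q_s)`
  have hii : ∀ t ∈ Icc 0 S.L, ∀ s ∈ Icc 0 S.L,
      (S.condExp (k + 1) f (update q ⟨k, hk⟩ t) - S.condExp (k + 1) f (update q ⟨k, hk⟩ s)) ^ 2 ≤
        2 * α + 2 * δ ^ 2 *
          S.condExp (k + 1) (fun p => (S.condExp (k + 2) f p - S.condExp (k + 1) f p) ^ 2) (update q ⟨k, hk⟩ s) := by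
    intro t ht s hs
    -- sections
    have hfs : Continuous fun p => f (update p ⟨k, hk⟩ s) := hf.comp (continuous_id.update _ continuous_const)
    have hft : Continuous fun p => f (update p ⟨k, hk⟩ t) := hf.comp (continuous_id.update _ continuous_const)
    have hgk : DependsOn (fun p => f (update p ⟨k, hk⟩ s)) {j : Fin N | j ≠ ⟨k, hk⟩} := by
      intro p p' hpp'
      show f (update p ⟨k, hk⟩ s) = f (update p' ⟨k, hk⟩ s)
      congr 1
      funext j
      by_cases hj : j = ⟨k, hk⟩
      · subst hj; simp
      · rw [update_of_ne hj, update_of_ne hj]; exact hpp' j hj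
    -- `u(q_r) = E_{k+1}(f(·[k↦r]))(q_r)`
    have hsec : ∀ r, S.condExp (k + 1) f (update q ⟨k, hk⟩ r) =
        S.condExp (k + 1) (fun p => f (update p ⟨k, hk⟩ r)) (update q ⟨k, hk⟩ r) :=
      fun r => S.condExp_update_eq_condExp_section (k := k + 1) (i := ⟨k, hk⟩) (Nat.lt_succ_self k) f q r
    -- FIRST and SECOND
    set FIRST := S.condExp (k + 1) (fun p => f (update p ⟨k, hk⟩ t) - f (update p ⟨k, hk⟩ s)) (update q ⟨k, hk⟩ t)
      with hFIRST
    set SECOND := S.condExp (k + 1) (fun p => f (update p ⟨k, hk⟩ s)) (update q ⟨k, hk⟩ t) -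
      S.condExp (k + 1) (fun p => f (update p ⟨k, hk⟩ s)) (update q ⟨k, hk⟩ s) with hSECOND
    have hsplit : S.condExp (k + 1) f (update q ⟨k, hk⟩ t) - S.condExp (k + 1) f (update q ⟨k, hk⟩ s) =
        FIRST + SECOND := by
      rw [hsec t, hsec s, hFIRST, hSECOND]
      have hsub := S.condExp_sub (k + 1) (f := fun p => f (update p ⟨k, hk⟩ t))
        (g := fun p => f (update p ⟨k, hk⟩ s)) hft hfs
      have e : (fun p => f (update p ⟨k, hk⟩ t) - f (update p ⟨k, hk⟩ s)) =
          (fun p => f (update p ⟨k, hk⟩ t)) - fun p => f (update p ⟨k, hk⟩ s) := rfl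
      rw [e, hsub, Pi.sub_apply]
      ring
    have hF : FIRST ^ 2 ≤ α := S.sq_condExp_section_sub_le hk hf hf' hd q ht hs
    -- SECOND
    have hS1 := S.abs_condExp_update_sub_le hk hfs hgk q t s
    have hX : Continuous fun p => |S.condExp (k + 2) (fun p => f (update p ⟨k, hk⟩ s)) p -
        S.condExp (k + 1) (fun p => f (update p ⟨k, hk⟩ s)) p| :=
      ((S.continuous_condExp _ hfs).sub (S.continuous_condExp _ hfs)).abs
    have hS2 : (S.condExp (k + 1) (fun p => |S.condExp (k + 2) (fun p => f (update p ⟨k, hk⟩ s)) p -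
        S.condExp (k + 1) (fun p => f (update p ⟨k, hk⟩ s)) p|) (update q ⟨k, hk⟩ s)) ^ 2 ≤
        S.condExp (k + 1) (fun p => (S.condExp (k + 2) f p - S.condExp (k + 1) f p) ^ 2) (update q ⟨k, hk⟩ s) := by
      refine (S.sq_condExp_le (k + 1) hX _).trans (le_of_eq ?_)
      -- on the fibre of `q[k↦s]` the sections agree with `f`
      refine S.condExp_congr_fibre (k + 1) _ _ _ fun y => ?_
      rw [sq_abs, updateFinset_update_tail hk]
      have e2 := S.condExp_update_eq_condExp_section (k := k + 2) (i := ⟨k, hk⟩) (by show k < k + 2; omega) f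
        (updateFinset q (tail (k + 1)) y) s
      have e1 := S.condExp_update_eq_condExp_section (k := k + 1) (i := ⟨k, hk⟩) (Nat.lt_succ_self k) f
        (updateFinset q (tail (k + 1)) y) s
      rw [← e1, ← e2]
    have hS : SECOND ^ 2 ≤ δ ^ 2 *
        S.condExp (k + 1) (fun p => (S.condExp (k + 2) f p - S.condExp (k + 1) f p) ^ 2) (update q ⟨k, hk⟩ s) := by
      have hE0 : 0 ≤ S.condExp (k + 1) (fun p => |S.condExp (k + 2) (fun p => f (update p ⟨k, hk⟩ s)) p -
          S.condExp (k + 1) (fun p => f (update p ⟨k, hk⟩ s)) p|) (update q ⟨k, hk⟩ s) :=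
        S.condExp_nonneg _ (fun _ => abs_nonneg _) _
      have hδ0 : 0 ≤ δ := by
        have hρ := S.one_le_ratio (Fin.pos ⟨k, hk⟩)
        rw [hδ]; exact mul_nonneg (by positivity) (by linarith)
      calc SECOND ^ 2 = |SECOND| ^ 2 := (sq_abs _).symm
        _ ≤ (δ * S.condExp (k + 1) (fun p => |S.condExp (k + 2) (fun p => f (update p ⟨k, hk⟩ s)) p -
              S.condExp (k + 1) (fun p => f (update p ⟨k, hk⟩ s)) p|) (update q ⟨k, hk⟩ s)) ^ 2 :=
            pow_le_pow_left₀ (abs_nonneg _) hS1 2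
        _ = δ ^ 2 * (S.condExp (k + 1) (fun p => |S.condExp (k + 2) (fun p => f (update p ⟨k, hk⟩ s)) p -
              S.condExp (k + 1) (fun p => f (update p ⟨k, hk⟩ s)) p|) (update q ⟨k, hk⟩ s)) ^ 2 := by ring
        _ ≤ _ := mul_le_mul_of_nonneg_left hS2 (sq_nonneg _)
    rw [hsplit]
    nlinarith [hF, hS, sq_nonneg (FIRST - SECOND)]
  -- (iii) for every `t ∈ [0,L]`: `(u(q_t) - ū)² ≤ 2α + 2δ² E_k[d₂²](q)`
  have hiii : ∀ t ∈ Icc 0 S.L, (S.condExp (k + 1) f (update q ⟨k, hk⟩ t) - ū) ^ 2 ≤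
      2 * α + 2 * δ ^ 2 * S.condExp k (fun p => (S.condExp (k + 2) f p - S.condExp (k + 1) f p) ^ 2) q := by
    intro t ht
    set ct : ℝ := S.condExp (k + 1) f (update q ⟨k, hk⟩ t) with hct
    have hcu : Continuous fun p => ct - S.condExp (k + 1) f p := continuous_const.sub hu
    -- `ct - ū = E_k[ct - u](q)`
    have hmean : ct - ū = S.condExp k (fun p => ct - S.condExp (k + 1) f p) q := by
      have hsub := S.condExp_sub k (f := fun _ => ct) (g := S.condExp (k + 1) f) continuous_const hu
      rw [S.condExp_const, S.condExp_condExp_succ k hf] at hsub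
      have := congrFun hsub q
      simp only [Pi.sub_apply] at this
      rw [hū, ← this]
      rfl
    -- Jensen, then comparison of one-step averages
    have hJ := S.sq_condExp_le k hcu q
    have hcomp : S.condExp k (fun p => (ct - S.condExp (k + 1) f p) ^ 2) q ≤
        S.condExp k (fun p => 2 * α + 2 * δ ^ 2 * (S.condExp (k + 2) f p - S.condExp (k + 1) f p) ^ 2) q := by
      refine S.condExp_le_condExp_of_forall_le hk (h := fun p => (ct - S.condExp (k + 1) f p) ^ 2)
        (h' := fun p => 2 * α + 2 * δ ^ 2 * (S.condExp (k + 2) f p - S.condExp (k + 1) f p) ^ 2)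
        (hcu.pow 2) hH' q fun s hs => ?_
      -- left: `(ct - u(q_s))²`; right: `2α + 2δ² E_{k+1}[d₂²](q_s)`
      have hl : S.condExp (k + 1) (fun p => (ct - S.condExp (k + 1) f p) ^ 2) (update q ⟨k, hk⟩ s) =
          (ct - S.condExp (k + 1) f (update q ⟨k, hk⟩ s)) ^ 2 := by
        have hdep : DependsOn (fun p => (ct - S.condExp (k + 1) f p) ^ 2) {i : Fin N | i.val < k + 1} :=
          fun p p' hpp' => by simp only [S.dependsOn_condExp (k + 1) f hpp']
        rw [S.condExp_of_dependsOn (k + 1) hdep]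
      have hr : S.condExp (k + 1) (fun p => 2 * α + 2 * δ ^ 2 * (S.condExp (k + 2) f p - S.condExp (k + 1) f p) ^ 2)
            (update q ⟨k, hk⟩ s) =
          2 * α + 2 * δ ^ 2 *
            S.condExp (k + 1) (fun p => (S.condExp (k + 2) f p - S.condExp (k + 1) f p) ^ 2) (update q ⟨k, hk⟩ s) := by
        have hadd := S.condExp_add (k + 1) (f := fun _ => 2 * α)
          (g := fun p => 2 * δ ^ 2 * (S.condExp (k + 2) f p - S.condExp (k + 1) f p) ^ 2)
          continuous_const (continuous_const.mul hd2)
        have hmul := S.condExp_mul_left (k + 1) (g := fun _ => 2 * δ ^ 2) (fun _ _ _ => rfl)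
          (fun p => (S.condExp (k + 2) f p - S.condExp (k + 1) f p) ^ 2)
        rw [S.condExp_const, hmul] at hadd
        exact congrFun hadd _
      rw [hl, hr]
      exact hii t ht s hs
    have hrhs : S.condExp k (fun p => 2 * α + 2 * δ ^ 2 * (S.condExp (k + 2) f p - S.condExp (k + 1) f p) ^ 2) q =
        2 * α + 2 * δ ^ 2 * S.condExp k (fun p => (S.condExp (k + 2) f p - S.condExp (k + 1) f p) ^ 2) q := by
      have hadd := S.condExp_add k (f := fun _ => 2 * α)
        (g := fun p => 2 * δ ^ 2 * (S.condExp (k + 2) f p - S.condExp (k + 1) f p) ^ 2)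
        continuous_const (continuous_const.mul hd2)
      have hmul := S.condExp_mul_left k (g := fun _ => 2 * δ ^ 2) (fun _ _ _ => rfl)
        (fun p => (S.condExp (k + 2) f p - S.condExp (k + 1) f p) ^ 2)
      rw [S.condExp_const, hmul] at hadd
      exact congrFun hadd _
    calc (ct - ū) ^ 2 = (S.condExp k (fun p => ct - S.condExp (k + 1) f p) q) ^ 2 := by rw [hmean]
      _ ≤ S.condExp k (fun p => (ct - S.condExp (k + 1) f p) ^ 2) q := hJ
      _ ≤ _ := hcomp
      _ = _ := hrhs
  -- (iv) average over `t`
  have hfinal := S.condExp_le_of_forall_le hk (h := fun p => (S.condExp (k + 1) f p - S.condExp k f p) ^ 2)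
    ((hu.sub hEk).pow 2) q
    (B := 2 * α + 2 * δ ^ 2 * S.condExp k (fun p => (S.condExp (k + 2) f p - S.condExp (k + 1) f p) ^ 2) q)
    fun t ht => by rw [hi t]; exact hiii t ht
  refine hfinal.trans (le_of_eq ?_)
  simp only [hα, hδ]
  ring

end StepMain

end Spec

end BoxChain

end Literature.Probability.LatticeModels

end
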